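import Mathlib
import Literature.Analysis.FluidPDE.LoopCirculation
import HarnessLib

/-!
# Route `TautLoopKelvin`, crux `TautLoopLaw` (stmt-NavierStokesRegularity-15249), line
  `Sketch-ideas-r1k1` (Dini–Saks architecture) — tools stub `stub_tautLoopStepSixPointTools`

The **six-point coordinate average** `M_a f(x) := ⅙ Σ_{i<3} (f(x + a eᵢ) + f(x − a eᵢ))`
(`eᵢ = EuclideanSpace.single i 1`) replacing the heat semigroup in the random-walk selection of
the line, for fields `f : ℝ³ → ℝ³`:

1. **Consistency with the Laplacian.** If `f ∈ C⁴` with `‖D⁴f‖ ≤ F₄`, then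
   `‖M_a f(x) − f(x) − (a²/6) Δf(x)‖ ≤ F₄ a⁴` (`Δ` = Mathlib's `Laplacian.laplacian`): along each
   coordinate line the symmetric second difference `f(x + w) + f(x − w) − 2f(x) − D²f(x)(w,w)`,
   `w = a eᵢ`, is bounded by `2 sup ‖D⁴f(·)(w,w,w,w)‖ ≤ 2 F₄ a⁴` (four applications of the mean
   value inequality to `τ ↦ f(x + τw) + f(x − τw) − 2f(x) − τ² D²f(x)(w,w)` and its derivatives,
   all vanishing at `τ = 0`), and `Σᵢ D²f(x)(eᵢ,eᵢ) = Δf(x)`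
   (`laplacian_eq_iteratedFDeriv_orthonormalBasis` for `EuclideanSpace.basisFun`).
2. **Circulation.** The circulation of `M_a f` around a `C¹` loop `γ` is the average of the
   circulations of `f` around the six translates `γ ± a eᵢ` (`circulation_loop_add_const`,
   linearity of the circulation in the field).
3. **Gradients.** The gradient of the averaged scalar is the average of the gradients.
4. **Sup norm.** `‖M_a f‖∞ ≤ ‖f‖∞`.

All statements are folklore; everything is proved from Mathlib and the loop API of
`Literature.Analysis.FluidPDE.LoopCirculation`.
-/

noncomputable section

open Set MeasureTheory Filter Topology Function Real intervalIntegral InnerProductSpace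
  Literature.Analysis.FluidPDE
open scoped InnerProductSpace RealInnerProductSpace Laplacian Gradient

namespace Summit.NavierStokesRegularity.NavierStokesRegularity.Theorems

set_option linter.dupNamespace false

local notation3 "E3" => EuclideanSpace ℝ (Fin 3)

local notation3 "𝐞[" i "]" => (EuclideanSpace.single (i : Fin 3) (1:ℝ) : EuclideanSpace ℝ (Fin 3))

/-! ## Derivatives along a line and the mean value inequality -/

/-- **Line derivative of an iterated derivative.** For `f ∈ C^n` and `k < n`,
`d/dτ D^k f(x + τ w)(w, …, w) = D^{k+1} f(x + τ w)(w, …, w)`. [folklore] -/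
theorem tautLoopSix_hasDerivAt_iteratedFDeriv_line {E F : Type*} [NormedAddCommGroup E]
    [NormedSpace ℝ E] [NormedAddCommGroup F] [NormedSpace ℝ F] {f : E → F} {n : WithTop ℕ∞}
    {k : ℕ} (hf : ContDiff ℝ n f) (hk : (k : WithTop ℕ∞) < n) (x w : E) (σ : ℝ) :
    HasDerivAt (fun τ : ℝ => iteratedFDeriv ℝ k f (x + τ • w) (fun _ => w))
      (iteratedFDeriv ℝ (k + 1) f (x + σ • w) (fun _ => w)) σ := by
  have hd : DifferentiableAt ℝ (iteratedFDeriv ℝ k f) (x + σ • w) :=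
    (hf.differentiable_iteratedFDeriv hk) _
  have hline : HasDerivAt (fun τ : ℝ => x + τ • w) w σ := by
    simpa using ((hasDerivAt_id σ).smul_const w).const_add x
  have h := (hd.hasFDerivAt.continuousMultilinear_apply_const (fun _ : Fin k => w)).comp_hasDerivAt
    σ hline
  have h' : HasDerivAt (fun τ : ℝ => iteratedFDeriv ℝ k f (x + τ • w) (fun _ => w))
      (((fderiv ℝ (iteratedFDeriv ℝ k f) (x + σ • w)) w) (fun _ => w)) σ := by
    simpa [Function.comp_def] using h
  rw [iteratedFDeriv_succ_apply_left]
  exact h'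

/-- **Mean value inequality from `0`.** If `ψ(0) = 0`, `ψ' ` is a derivative of `ψ` and
`‖ψ'‖ ≤ C` on `[0, 1]`, then `‖ψ‖ ≤ C` on `[0, 1]`. [folklore] -/
theorem tautLoopSix_norm_le_of_hasDerivAt {F : Type*} [NormedAddCommGroup F] [NormedSpace ℝ F]
    {ψ ψ' : ℝ → F} {C : ℝ} (hψ : ∀ τ, HasDerivAt ψ (ψ' τ) τ) (h0 : ψ 0 = 0)
    (hC : ∀ τ ∈ Icc (0:ℝ) 1, ‖ψ' τ‖ ≤ C) : ∀ τ ∈ Icc (0:ℝ) 1, ‖ψ τ‖ ≤ C := by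
  intro τ hτ
  have hC0 : 0 ≤ C := (norm_nonneg _).trans (hC 0 ⟨le_rfl, zero_le_one⟩)
  have key := norm_image_sub_le_of_norm_deriv_le_segment' (a := 0) (b := 1)
    (fun t _ => (hψ t).hasDerivWithinAt) (fun t ht => hC t (Ico_subset_Icc_self ht)) τ hτ
  rw [h0, sub_zero, sub_zero] at key
  calc ‖ψ τ‖ ≤ C * τ := key
    _ ≤ C * 1 := by gcongr; exact hτ.2
    _ = C := mul_one C

/-- **Symmetric second difference vs. second derivative, fourth order.** For `f ∈ C⁴` and
`‖D⁴f(x + τ w)(w,w,w,w)‖ ≤ M` for all `τ`,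
`‖f(x + w) + f(x − w) − 2 f(x) − D²f(x)(w,w)‖ ≤ 2M` (the sharp constant is `M/12`; four mean
value inequalities applied to `φ(τ) = f(x + τw) + f(x − τw) − 2f(x) − τ² D²f(x)(w,w)` and its
first three derivatives, all of which vanish at `τ = 0`). [folklore] -/
theorem tautLoopSix_secondDiff_le {E F : Type*} [NormedAddCommGroup E] [NormedSpace ℝ E]
    [NormedAddCommGroup F] [NormedSpace ℝ F] {f : E → F} (hf : ContDiff ℝ 4 f) (x w : E) {M : ℝ}
    (hM : ∀ τ : ℝ, ‖iteratedFDeriv ℝ 4 f (x + τ • w) (fun _ => w)‖ ≤ M) :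
    ‖f (x + w) + f (x - w) - (2:ℝ) • f x - iteratedFDeriv ℝ 2 f x (fun _ => w)‖ ≤ 2 * M := by
  -- the line derivatives `g k τ = D^k f (x + τ w) (w, …, w)`
  obtain ⟨g, hg⟩ : ∃ g : ℕ → ℝ → F, ∀ k τ,
      g k τ = iteratedFDeriv ℝ k f (x + τ • w) (fun _ => w) := ⟨_, fun _ _ => rfl⟩
  have hder : ∀ k : ℕ, k < 4 → ∀ τ, HasDerivAt (g k) (g (k + 1) τ) τ := by
    intro k hk τ
    have hfun : g k = fun s => iteratedFDeriv ℝ k f (x + s • w) (fun _ => w) := funext (hg k)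
    rw [hfun, hg]
    exact tautLoopSix_hasDerivAt_iteratedFDeriv_line hf (by exact_mod_cast hk) x w τ
  have hneg : ∀ k : ℕ, k < 4 → ∀ τ, HasDerivAt (fun s => g k (-s)) (-g (k + 1) (-τ)) τ := by
    intro k hk τ
    have h := (hder k hk (-τ)).scomp τ (hasDerivAt_neg τ)
    simpa [Function.comp_def] using h
  have hM' : ∀ τ, ‖g 4 τ‖ ≤ M := fun τ => by rw [hg]; exact hM τ
  -- level 3: `φ‴(τ) = g₃(τ) - g₃(-τ)`
  have h3 : ∀ τ ∈ Icc (0:ℝ) 1, ‖g 3 τ - g 3 (-τ)‖ ≤ 2 * M := by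
    refine tautLoopSix_norm_le_of_hasDerivAt (ψ' := fun τ => g 4 τ + g 4 (-τ))
      (fun τ => ?_) (by simp) (fun τ _ => ?_)
    · exact ((hder 3 (by norm_num) τ).fun_sub (hneg 3 (by norm_num) τ)).congr_deriv (by abel)
    · calc ‖g 4 τ + g 4 (-τ)‖ ≤ ‖g 4 τ‖ + ‖g 4 (-τ)‖ := norm_add_le _ _
        _ ≤ M + M := add_le_add (hM' τ) (hM' (-τ))
        _ = 2 * M := by ring
  -- level 2: `φ″(τ) = g₂(τ) + g₂(-τ) - 2 g₂(0)`
  have h2 : ∀ τ ∈ Icc (0:ℝ) 1, ‖g 2 τ + g 2 (-τ) - (2:ℝ) • g 2 0‖ ≤ 2 * M := by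
    refine tautLoopSix_norm_le_of_hasDerivAt (ψ' := fun τ => g 3 τ - g 3 (-τ))
      (fun τ => ?_) ?_ h3
    · exact (((hder 2 (by norm_num) τ).fun_add (hneg 2 (by norm_num) τ)).sub_const _).congr_deriv
        (by abel)
    · simp [two_smul]
  -- level 1: `φ′(τ) = g₁(τ) - g₁(-τ) - 2τ g₂(0)`
  have h1 : ∀ τ ∈ Icc (0:ℝ) 1, ‖g 1 τ - g 1 (-τ) - (2 * τ) • g 2 0‖ ≤ 2 * M := by
    refine tautLoopSix_norm_le_of_hasDerivAt (ψ' := fun τ => g 2 τ + g 2 (-τ) - (2:ℝ) • g 2 0)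
      (fun τ => ?_) ?_ h2
    · have hlin : HasDerivAt (fun s : ℝ => (2 * s) • g 2 0) ((2 * 1 : ℝ) • g 2 0) τ :=
        ((hasDerivAt_id' τ).const_mul 2).smul_const _
      exact (((hder 1 (by norm_num) τ).fun_sub (hneg 1 (by norm_num) τ)).fun_sub hlin).congr_deriv
        (by rw [mul_one, sub_neg_eq_add])
    · simp
  -- level 0: `φ(τ) = g₀(τ) + g₀(-τ) - 2 g₀(0) - τ² g₂(0)`
  have h0 : ∀ τ ∈ Icc (0:ℝ) 1,
      ‖g 0 τ + g 0 (-τ) - (2:ℝ) • g 0 0 - (τ ^ 2) • g 2 0‖ ≤ 2 * M := by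
    refine tautLoopSix_norm_le_of_hasDerivAt (ψ' := fun τ => g 1 τ - g 1 (-τ) - (2 * τ) • g 2 0)
      (fun τ => ?_) ?_ h1
    · have hsq : HasDerivAt (fun s : ℝ => (s ^ 2) • g 2 0) (((2:ℕ) * τ ^ (2 - 1) : ℝ) • g 2 0) τ :=
        (hasDerivAt_pow 2 τ).smul_const _
      exact ((((hder 0 (by norm_num) τ).fun_add (hneg 0 (by norm_num) τ)).sub_const _).fun_sub
        hsq).congr_deriv (by rw [← sub_eq_add_neg]; norm_num)
    · simp [two_smul]
  have key := h0 1 ⟨zero_le_one, le_rfl⟩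
  simp only [hg, iteratedFDeriv_zero_apply, one_smul, neg_smul, zero_smul, add_zero, one_pow,
    ← sub_eq_add_neg] at key
  exact key

/-! ## The six-point average -/

/-- **Consistency of the six-point average with the Laplacian** for `C⁴` fields `ℝ³ → ℝ³` with
`‖D⁴f‖ ≤ F₄`: `‖⅙ Σᵢ (f(x + a eᵢ) + f(x − a eᵢ)) − f(x) − (a²/6) Δf(x)‖ ≤ F₄ a⁴`. [folklore] -/
theorem tautLoopSix_consistency (f : E3 → E3) (a F₄ : ℝ) (ha : 0 ≤ a) (hf : ContDiff ℝ 4 f)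
    (hF : ∀ x, ‖iteratedFDeriv ℝ 4 f x‖ ≤ F₄) (x : E3) :
    ‖(1 / 6 : ℝ) • (∑ i : Fin 3, (f (x + a • 𝐞[i]) + f (x - a • 𝐞[i]))) - f x -
      (a ^ 2 / 6) • Δ f x‖ ≤ F₄ * a ^ 4 := by
  -- the Laplacian along the standard basis
  have hΔ : Δ f x = ∑ i : Fin 3, iteratedFDeriv ℝ 2 f x (fun _ => 𝐞[i]) := by
    have h := congrFun (laplacian_eq_iteratedFDeriv_orthonormalBasis f
      (EuclideanSpace.basisFun (Fin 3) ℝ)) x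
    rw [h]
    refine Finset.sum_congr rfl fun i _ => ?_
    congr 1
    funext j
    fin_cases j <;> simp
  -- per-direction fourth-order bound
  have hdir : ∀ i : Fin 3, ‖f (x + a • 𝐞[i]) + f (x - a • 𝐞[i]) - (2:ℝ) • f x -
      iteratedFDeriv ℝ 2 f x (fun _ => a • 𝐞[i])‖ ≤ 2 * (F₄ * a ^ 4) := by
    intro i
    have hnorm : ‖a • 𝐞[i]‖ = a := by
      rw [norm_smul, Real.norm_of_nonneg ha]
      simp
    refine tautLoopSix_secondDiff_le hf x (a • 𝐞[i]) fun τ => ?_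
    calc ‖iteratedFDeriv ℝ 4 f (x + τ • a • 𝐞[i]) (fun _ => a • 𝐞[i])‖
        ≤ ‖iteratedFDeriv ℝ 4 f (x + τ • a • 𝐞[i])‖ * ∏ _j : Fin 4, ‖a • 𝐞[i]‖ :=
          ContinuousMultilinearMap.le_opNorm _ _
      _ ≤ F₄ * a ^ 4 := by
          rw [Finset.prod_const, Finset.card_univ, Fintype.card_fin, hnorm]
          exact mul_le_mul_of_nonneg_right (hF _) (by positivity)
  -- homogeneity `D²f(x)(a e, a e) = a² D²f(x)(e, e)`
  have hhom : ∀ i : Fin 3, iteratedFDeriv ℝ 2 f x (fun _ => a • 𝐞[i]) =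
      a ^ 2 • iteratedFDeriv ℝ 2 f x (fun _ => 𝐞[i]) := by
    intro i
    rw [show (fun _ : Fin 2 => a • 𝐞[i]) = fun j => (fun _ : Fin 2 => a) j • (fun _ : Fin 2 => 𝐞[i]) j
      from rfl, ContinuousMultilinearMap.map_smul_univ]
    simp [sq]
  have hid : (1 / 6 : ℝ) • (∑ i : Fin 3, (f (x + a • 𝐞[i]) + f (x - a • 𝐞[i]))) - f x -
      (a ^ 2 / 6) • Δ f x = (1 / 6 : ℝ) • ∑ i : Fin 3, (f (x + a • 𝐞[i]) + f (x - a • 𝐞[i]) -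
        (2:ℝ) • f x - iteratedFDeriv ℝ 2 f x (fun _ => a • 𝐞[i])) := by
    simp only [hΔ, hhom, Fin.sum_univ_three]
    module
  rw [hid, norm_smul, Real.norm_of_nonneg (by norm_num : (0:ℝ) ≤ 1 / 6)]
  have hsum := (norm_sum_le _ _).trans (Finset.sum_le_sum fun i (_ : i ∈ Finset.univ) => hdir i)
  refine (mul_le_mul_of_nonneg_left hsum (by norm_num)).trans_eq ?_
  simp only [Finset.sum_const, Finset.card_univ, Fintype.card_fin, nsmul_eq_mul]
  ring

/-- **Circulation of the six-point average**: for a continuous field `f` and a closed `C¹` loop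
`γ`, `∮_γ M_a f · dℓ = ⅙ Σᵢ (∮_{γ + a eᵢ} f · dℓ + ∮_{γ − a eᵢ} f · dℓ)`. [folklore] -/
theorem tautLoopSix_circulation_average (f : E3 → E3) (a : ℝ) (γ : ℝ → E3) (hf : Continuous f)
    (hγ : IsC1Loop γ) :
    circulation (fun x => (1 / 6 : ℝ) • (∑ i : Fin 3, (f (x + a • 𝐞[i]) + f (x - a • 𝐞[i])))) γ =
      (1 / 6 : ℝ) * ∑ i : Fin 3, (circulation f (fun s => γ s + a • 𝐞[i]) +
        circulation f (fun s => γ s - a • 𝐞[i])) := by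
  have hp : ∀ c : E3, IntervalIntegrable (fun s => ⟪f (γ s + c), deriv γ s⟫) volume 0 1 :=
    fun c => ((hf.comp (hγ.continuous.add continuous_const)).inner
      hγ.continuous_deriv).intervalIntegrable 0 1
  have hm : ∀ c : E3, IntervalIntegrable (fun s => ⟪f (γ s - c), deriv γ s⟫) volume 0 1 :=
    fun c => ((hf.comp (hγ.continuous.sub continuous_const)).inner
      hγ.continuous_deriv).intervalIntegrable 0 1
  simp only [circulation, deriv_add_const, deriv_sub_const, real_inner_smul_left, sum_inner,
    inner_add_left]
  rw [intervalIntegral.integral_const_mul,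
    intervalIntegral.integral_finsetSum fun i _ => (hp _).add (hm _)]
  congr 1
  refine Finset.sum_congr rfl fun i _ => ?_
  exact intervalIntegral.integral_add (hp _) (hm _)

/-- **Gradient of the six-point average of a scalar**: for differentiable `q : ℝ³ → ℝ`,
`∇(M_a q)(x) = ⅙ Σᵢ (∇q(x + a eᵢ) + ∇q(x − a eᵢ))`. [folklore] -/
theorem tautLoopSix_gradient_average (q : E3 → ℝ) (a : ℝ) (hq : Differentiable ℝ q) (x : E3) :
    gradient (fun y => (1 / 6 : ℝ) * (∑ i : Fin 3, (q (y + a • 𝐞[i]) + q (y - a • 𝐞[i])))) x =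
      (1 / 6 : ℝ) • (∑ i : Fin 3, (gradient q (x + a • 𝐞[i]) + gradient q (x - a • 𝐞[i]))) := by
  have hp : ∀ c : E3, HasFDerivAt (fun y => q (y + c)) (fderiv ℝ q (x + c)) x := fun c => by
    have h := (hq (x + c)).hasFDerivAt.comp x ((hasFDerivAt_id x).add_const c)
    simpa [Function.comp_def] using h
  have hm : ∀ c : E3, HasFDerivAt (fun y => q (y - c)) (fderiv ℝ q (x - c)) x := fun c => by
    have h := (hq (x - c)).hasFDerivAt.comp x ((hasFDerivAt_id x).sub_const c)
    simpa [Function.comp_def] using h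
  have hd : HasFDerivAt (fun y => (1 / 6 : ℝ) * (∑ i : Fin 3, (q (y + a • 𝐞[i]) + q (y - a • 𝐞[i]))))
      ((1 / 6 : ℝ) • ∑ i : Fin 3, (fderiv ℝ q (x + a • 𝐞[i]) + fderiv ℝ q (x - a • 𝐞[i]))) x :=
    (HasFDerivAt.fun_sum fun i _ => (hp _).add (hm _)).const_mul (1 / 6)
  have heq : (1 / 6 : ℝ) • ∑ i : Fin 3, (fderiv ℝ q (x + a • 𝐞[i]) + fderiv ℝ q (x - a • 𝐞[i])) =
      toDual ℝ E3 ((1 / 6 : ℝ) • (∑ i : Fin 3,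
        (gradient q (x + a • 𝐞[i]) + gradient q (x - a • 𝐞[i])))) := by
    simp only [map_smulₛₗ, map_sum, map_add, toDual_gradient]
    simp
  have hG : HasGradientAt
      (fun y => (1 / 6 : ℝ) * (∑ i : Fin 3, (q (y + a • 𝐞[i]) + q (y - a • 𝐞[i]))))
      ((1 / 6 : ℝ) • (∑ i : Fin 3, (gradient q (x + a • 𝐞[i]) + gradient q (x - a • 𝐞[i])))) x := by
    rw [hasGradientAt_iff_hasFDerivAt]
    exact hd.congr_fderiv heq
  exact hG.gradient

/-- **Sup-norm contraction of the six-point average**: `‖f‖ ≤ B` implies `‖M_a f‖ ≤ B`.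
[folklore] -/
theorem tautLoopSix_sup_le (f : E3 → E3) (a B : ℝ) (hB : ∀ x, ‖f x‖ ≤ B) (x : E3) :
    ‖(1 / 6 : ℝ) • (∑ i : Fin 3, (f (x + a • 𝐞[i]) + f (x - a • 𝐞[i])))‖ ≤ B := by
  rw [norm_smul, Real.norm_of_nonneg (by norm_num : (0:ℝ) ≤ 1 / 6)]
  have hsum : ‖∑ i : Fin 3, (f (x + a • 𝐞[i]) + f (x - a • 𝐞[i]))‖ ≤ ∑ _i : Fin 3, (B + B) :=
    (norm_sum_le _ _).trans (Finset.sum_le_sum fun i _ =>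
      (norm_add_le _ _).trans (add_le_add (hB _) (hB _)))
  refine (mul_le_mul_of_nonneg_left hsum (by norm_num)).trans_eq ?_
  simp only [Finset.sum_const, Finset.card_univ, Fintype.card_fin, nsmul_eq_mul]
  ring

/-! ## The tools stub -/

/-- **Tools stub `stub_tautLoopStepSixPointTools`** (registered; serves the random-walk selection
and the step-from-selection of line `Sketch-ideas-r1k1`): the conjunction of (1) consistency of
the six-point coordinate average with the Laplacian for `C⁴` fields, (2) the circulation of the
average as the average of circulations around the six translated loops, (3) commutation of the
average with gradients of scalars, (4) the sup-norm contraction, with all binders explicit.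
[folklore] -/
theorem stub_tautLoopStepSixPointTools : (∀ (f : EuclideanSpace ℝ (Fin 3) → EuclideanSpace ℝ
    (Fin 3)) (a F₄ : ℝ), 0 ≤ a → ContDiff ℝ 4 f → (∀ x, ‖iteratedFDeriv ℝ 4 f x‖ ≤ F₄) → ∀ x,
    ‖(1 / 6 : ℝ) • (∑ i : Fin 3, (f (x + a • EuclideanSpace.single i (1:ℝ)) + f (x - a •
    EuclideanSpace.single i (1:ℝ)))) - f x - (a ^ 2 / 6) • Laplacian.laplacian f x‖ ≤ F₄ * a ^ 4)
    ∧ (∀ (f : EuclideanSpace ℝ (Fin 3) → EuclideanSpace ℝ (Fin 3)) (a : ℝ) (γ : ℝ →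
    EuclideanSpace ℝ (Fin 3)), Continuous f → Literature.Analysis.FluidPDE.IsC1Loop γ →
    Literature.Analysis.FluidPDE.circulation (fun x => (1 / 6 : ℝ) • (∑ i : Fin 3, (f (x + a •
    EuclideanSpace.single i (1:ℝ)) + f (x - a • EuclideanSpace.single i (1:ℝ))))) γ = (1 / 6 : ℝ)
    * ∑ i : Fin 3, (Literature.Analysis.FluidPDE.circulation f (fun s => γ s + a •
    EuclideanSpace.single i (1:ℝ)) + Literature.Analysis.FluidPDE.circulation f (fun s => γ s - a
    • EuclideanSpace.single i (1:ℝ)))) ∧ (∀ (q : EuclideanSpace ℝ (Fin 3) → ℝ) (a : ℝ),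
    Differentiable ℝ q → ∀ x, gradient (fun y => (1 / 6 : ℝ) * (∑ i : Fin 3, (q (y + a •
    EuclideanSpace.single i (1:ℝ)) + q (y - a • EuclideanSpace.single i (1:ℝ))))) x = (1 / 6 : ℝ)
    • (∑ i : Fin 3, (gradient q (x + a • EuclideanSpace.single i (1:ℝ)) + gradient q (x - a •
    EuclideanSpace.single i (1:ℝ))))) ∧ (∀ (f : EuclideanSpace ℝ (Fin 3) → EuclideanSpace ℝ
    (Fin 3)) (a B : ℝ), (∀ x, ‖f x‖ ≤ B) → ∀ x, ‖(1 / 6 : ℝ) • (∑ i : Fin 3, (f (x + a •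
    EuclideanSpace.single i (1:ℝ)) + f (x - a • EuclideanSpace.single i (1:ℝ))))‖ ≤ B) :=
  ⟨tautLoopSix_consistency, tautLoopSix_circulation_average, tautLoopSix_gradient_average,
    tautLoopSix_sup_le⟩

end Summit.NavierStokesRegularity.NavierStokesRegularity.Theorems

end
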